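import Literature.AlgebraicTopology.SingularHomology.CupProductSupports
import HarnessLib

/-!
# Singular cohomology does not depend on the ground ring

The tree's singular cohomology `singularCohomology R M X n` (`…SingularCochains`) is the
cohomology of the complex of `R`-modules of `M`-valued functions on singular simplices, for an
`R`-module `M`. Its underlying abelian group depends only on the abelian group `M`: the cochain
groups `Cⁿ(X; M) = (SingularSimplex X n → M)` do not mention `R`, and the coboundary
`(δφ)(σ) = ∑ᵢ (-1)ⁱ φ(σ ∘ δᵢ)` only uses the signs `(-1)ⁱ`, i.e. the `ℤ`-module structure
(A. Hatcher, *Algebraic Topology* (2002), §3.1 p. 197–198: `Cⁿ(X; G) = Hom(Cₙ(X), G)`,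
`Hⁿ(X; G)` for an abelian GROUP `G`). In Lean the two ground rings give complexes in different
categories (`ModuleCat R`, `ModuleCat S`), so the identification has to be written down; this file
does so, by hand on cocycles (pattern of `CohomologyRingChange.lean`):

* `singularCochainComplex.d_apply_eq_of_scalar`: the coboundaries of `C^•(X; M)` over `R` and
  over `S` agree as functions;
* `singularCochainComplex.cocyclesScalarChange R S : Zⁿ(X; M)_R →+ Zⁿ(X; M)_S` (identity on
  cochains) and **`singularCohomology.scalarChange R S M X n : Hⁿ(X; M)_R →+ Hⁿ(X; M)_S`**,
  computed on representatives (`scalarChange_π`), involutive (`scalarChange_scalarChange`),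
  natural in `X` (`scalarChange_map`), packaged as **`singularCohomology.scalarEquiv`**
  (`Hⁿ(X; M)_R ≃+ Hⁿ(X; M)_S`).

Typical use: `M = ℤ/2` regarded as a `ℤ`-module (the Bockstein sequence of `0 → ℤ → ℤ → ℤ/2 → 0`,
`CohomologyBockstein.lean`, lives over the ground ring `ℤ`) versus `ℤ/2` as a module over itself
(the cup product and the Steenrod squares, `SteenrodSquares.lean`, need ring coefficients):
`scalarEquiv ℤ (ZMod 2) (ZMod 2) X n`. Everything is proved; no named facts.

## References

* A. Hatcher, *Algebraic Topology*, CUP 2002, §3.1 pp. 197–198. [HatcherAT2002]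
-/

noncomputable section

open CategoryTheory

universe u v

namespace Literature.AlgebraicTopology.SingularHomology

variable (R S T : Type v) [CommRing R] [CommRing S] [CommRing T]
variable (M : Type v) [AddCommGroup M] [Module R M] [Module S M] [Module T M]
variable {X Y : Type u} [TopologicalSpace X] [TopologicalSpace Y] {n : ℕ}

namespace singularCochainComplex

/-! ### The coboundary only uses the `ℤ`-module structure -/

variable {R M} in
/-- `(-1)ⁱ • x`, computed with `(-1)ⁱ ∈ R`, is the integer multiple `(-1)ⁱ • x`. [folklore] -/
lemma neg_one_pow_smul_eq_zsmul (k : ℕ) (x : M) : ((-1 : R) ^ k) • x = ((-1 : ℤ) ^ k) • x := by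
  rw [← Int.cast_smul_eq_zsmul R, Int.cast_pow, Int.cast_neg, Int.cast_one]

variable {M} in
/-- **The singular coboundary does not depend on the ground ring**: for an abelian group `M`
which is both an `R`-module and an `S`-module, the coboundaries of `C^•(X; M)` formed in
`ModuleCat R` and in `ModuleCat S` agree on every cochain, both being
`(δφ)(σ) = ∑ᵢ (-1)ⁱ φ(σ ∘ δᵢ)` (Hatcher 2002, §3.1). [cite: HatcherAT2002, §3.1 p. 197] -/
theorem d_apply_eq_of_scalar (φ : SingularSimplex X n → M) (σ : SingularSimplex X (n + 1)) :
    (singularCochainComplex R M X).d n (n + 1) φ σ =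
      (singularCochainComplex S M X).d n (n + 1) φ σ := by
  rw [d_apply, d_apply]
  exact Finset.sum_congr rfl fun i _ ↦ by
    rw [neg_one_pow_smul_eq_zsmul, neg_one_pow_smul_eq_zsmul]

variable {M} in
/-- Function form of `d_apply_eq_of_scalar`: `δ_R φ = δ_S φ` as cochains. [cite: HatcherAT2002, §3.1 p. 197] -/
theorem d_eq_of_scalar (φ : SingularSimplex X n → M) :
    ((singularCochainComplex R M X).d n (n + 1) φ : SingularSimplex X (n + 1) → M) =
      (singularCochainComplex S M X).d n (n + 1) φ :=
  funext fun σ ↦ d_apply_eq_of_scalar R S φ σ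

/-! ### Cocycles -/

variable {R M} in
/-- The cochain of a cocycle over `R` is a cocycle over `S`. [folklore] -/
lemma d_iCocycles_of_scalar (u : cocycles R M X n) :
    (singularCochainComplex S M X).d n (n + 1) (iCocycles R M X n u : SingularSimplex X n → M) =
      0 := by
  refine singularCochainComplex.ext fun σ ↦ ?_
  rw [← d_apply_eq_of_scalar R S]
  exact d_iCocycles_apply (n + 1) u σ

/-- **Change of ground ring on cocycles**, the identity on cochains:
`Zⁿ(X; M)_R → Zⁿ(X; M)_S`, `u ↦ u` (a cocycle over `R` is a cocycle over `S` by
`d_eq_of_scalar`). [cite: HatcherAT2002, §3.1 p. 198] -/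
def cocyclesScalarChange (n : ℕ) : cocycles R M X n →+ cocycles S M X n where
  toFun u := cocyclesMk (iCocycles R M X n u : SingularSimplex X n → M) (d_iCocycles_of_scalar S u)
  map_zero' := cocycles_ext (by rw [iCocycles_mk, map_zero, map_zero]; rfl)
  map_add' u v := cocycles_ext (by
    rw [iCocycles_mk, map_add, map_add, iCocycles_mk, iCocycles_mk]; rfl)

/-- The cochain of `cocyclesScalarChange R S M n u` is the cochain of `u`. [folklore] -/
@[simp]
lemma iCocycles_cocyclesScalarChange (u : cocycles R M X n) :
    (iCocycles S M X n (cocyclesScalarChange R S M n u) : SingularSimplex X n → M) =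
      iCocycles R M X n u :=
  iCocycles_mk (iCocycles R M X n u : SingularSimplex X n → M) (d_iCocycles_of_scalar S u)

/-- Changing the ground ring there and back is the identity on cocycles. [folklore] -/
@[simp]
lemma cocyclesScalarChange_cocyclesScalarChange (u : cocycles R M X n) :
    cocyclesScalarChange S R M n (cocyclesScalarChange R S M n u) = u :=
  cocycles_ext (by rw [iCocycles_cocyclesScalarChange, iCocycles_cocyclesScalarChange])

/-- `cocyclesScalarChange R R = id`. [folklore] -/
@[simp]
lemma cocyclesScalarChange_self (u : cocycles R M X n) : cocyclesScalarChange R R M n u = u :=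
  cocycles_ext (by rw [iCocycles_cocyclesScalarChange])

/-- Change of ground ring on cocycles commutes with coboundaries: the image of `δ_R w` is
`δ_S w`. [folklore] -/
lemma cocyclesScalarChange_toCocycles (k : ℕ) (w : SingularSimplex X k → M) :
    cocyclesScalarChange R S M n (toCocycles R M X k n w) = toCocycles S M X k n w := by
  refine cocycles_ext ?_
  rw [iCocycles_cocyclesScalarChange, iCocycles_toCocycles, iCocycles_toCocycles]
  by_cases hk : k + 1 = n
  · subst hk
    exact d_eq_of_scalar R S w
  · rw [(singularCochainComplex R M X).shape _ _ hk, (singularCochainComplex S M X).shape _ _ hk]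
    rfl

/-- Change of ground ring on cocycles commutes with pull-back along continuous maps
(both are composition of cochains with `f`). [folklore] -/
lemma cocyclesScalarChange_cocyclesMap (f : C(X, Y)) (u : cocycles R M Y n) :
    cocyclesScalarChange R S M n (cocyclesMap R M f n u) =
      cocyclesMap S M f n (cocyclesScalarChange R S M n u) := by
  refine cocycles_ext ?_
  rw [iCocycles_cocyclesScalarChange, iCocycles_cocyclesMap, iCocycles_cocyclesMap]
  refine singularCochainComplex.ext fun σ ↦ ?_
  rw [map_apply, map_apply]
  exact congrFun (iCocycles_cocyclesScalarChange R S M u).symm (σ.map f)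

end singularCochainComplex

namespace singularCohomology

open singularCochainComplex

/-! ### Cohomology -/

/-- Cocycles with the same class over `R` have the same class over `S` after change of ground
ring (their difference is a coboundary `δ_R w = δ_S w`). [cite: HatcherAT2002, §3.1 p. 198] -/
lemma π_cocyclesScalarChange_eq_of_π_eq {u v : cocycles R M X n}
    (h : singularCohomology.π R M X n u = singularCohomology.π R M X n v) :
    singularCohomology.π S M X n (cocyclesScalarChange R S M n u) =
      singularCohomology.π S M X n (cocyclesScalarChange R S M n v) := by
  have h0 : singularCohomology.π R M X n (u - v) = 0 := by rw [map_sub, h, sub_self]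
  obtain ⟨w, hw⟩ := (π_eq_zero_iff R (u - v)).1 h0
  have hw' : toCocycles R M X _ n w = u - v := cocycles_ext (by rw [iCocycles_toCocycles, hw])
  have key : cocyclesScalarChange R S M n u =
      cocyclesScalarChange R S M n v + toCocycles S M X _ n w := by
    rw [← cocyclesScalarChange_toCocycles R S, hw', map_sub, add_sub_cancel]
  rw [key, map_add, π_toCocycles, add_zero]

/-- Every class is represented by a cocycle (`π` is onto). [folklore] -/
lemma π_surjective' (n : ℕ) : Function.Surjective (singularCohomology.π R M X n) := fun x ↦ by
  induction x using singularCohomology_induction_on with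
  | h a => exact ⟨a, rfl⟩

/-- **Change of ground ring on singular cohomology**, `Hⁿ(X; M)_R →+ Hⁿ(X; M)_S`,
`[u] ↦ [u]`: the identity on representing cocycles (Hatcher 2002, §3.1: `Hⁿ(X; G)` depends only
on the abelian group `G`). Defined on a chosen representative; computed by `scalarChange_π`.
[cite: HatcherAT2002, §3.1 p. 198] -/
def scalarChange (X : Type u) [TopologicalSpace X] (n : ℕ) :
    singularCohomology R M X n →+ singularCohomology S M X n where
  toFun x := singularCohomology.π S M X n
    (cocyclesScalarChange R S M n (Classical.choose (π_surjective' R M n x)))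
  map_zero' := by
    rw [π_cocyclesScalarChange_eq_of_π_eq R S M
      ((Classical.choose_spec (π_surjective' R M n (0 : singularCohomology R M X n))).trans
        (map_zero (ConcreteCategory.hom (singularCohomology.π R M X n))).symm), map_zero, map_zero]
  map_add' x y := by
    induction x using singularCohomology_induction_on with
    | h u =>
    induction y using singularCohomology_induction_on with
    | h v =>
      rw [π_cocyclesScalarChange_eq_of_π_eq R S M
          (Classical.choose_spec (π_surjective' R M n (singularCohomology.π R M X n u))),
        π_cocyclesScalarChange_eq_of_π_eq R S M
          (Classical.choose_spec (π_surjective' R M n (singularCohomology.π R M X n v))),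
        ← map_add (ConcreteCategory.hom (singularCohomology.π R M X n)),
        π_cocyclesScalarChange_eq_of_π_eq R S M
          (Classical.choose_spec (π_surjective' R M n (singularCohomology.π R M X n (u + v)))),
        map_add, map_add]

/-- **Change of ground ring on representatives**: `scalarChange [u] = [u]`. [cite: HatcherAT2002, §3.1 p. 198] -/
@[simp]
theorem scalarChange_π (u : cocycles R M X n) :
    scalarChange R S M X n (singularCohomology.π R M X n u) =
      singularCohomology.π S M X n (cocyclesScalarChange R S M n u) :=
  π_cocyclesScalarChange_eq_of_π_eq R S M
    (Classical.choose_spec (π_surjective' R M n (singularCohomology.π R M X n u)))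

/-- Changing the ground ring there and back is the identity on cohomology. [folklore] -/
@[simp]
theorem scalarChange_scalarChange (x : singularCohomology R M X n) :
    scalarChange S R M X n (scalarChange R S M X n x) = x := by
  induction x using singularCohomology_induction_on with
  | h u => rw [scalarChange_π, scalarChange_π, cocyclesScalarChange_cocyclesScalarChange]

/-- `scalarChange R R = id`. [folklore] -/
@[simp]
theorem scalarChange_self (x : singularCohomology R M X n) : scalarChange R R M X n x = x := by
  induction x using singularCohomology_induction_on with
  | h u => rw [scalarChange_π, cocyclesScalarChange_self]

/-- Transitivity: changing `R → S → T` is changing `R → T`. [folklore] -/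
theorem scalarChange_trans (x : singularCohomology R M X n) :
    scalarChange S T M X n (scalarChange R S M X n x) = scalarChange R T M X n x := by
  induction x using singularCohomology_induction_on with
  | h u =>
    rw [scalarChange_π, scalarChange_π, scalarChange_π]
    congr 1
    exact cocycles_ext (by simp only [iCocycles_cocyclesScalarChange])

/-- **Naturality** of the change of ground ring: `scalarChange ∘ f^* = f^* ∘ scalarChange` for a
continuous map `f : X → Y` (both are computed by composing cochains with `f`).
[cite: HatcherAT2002, §3.1 p. 198] -/
theorem scalarChange_map (f : C(X, Y)) (x : singularCohomology R M Y n) :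
    scalarChange R S M X n (singularCohomology.map R M f n x) =
      singularCohomology.map S M f n (scalarChange R S M Y n x) := by
  induction x using singularCohomology_induction_on with
  | h u =>
    rw [singularCohomology.map_π, scalarChange_π, scalarChange_π, singularCohomology.map_π,
      cocyclesScalarChange_cocyclesMap]

/-- **Singular cohomology does not depend on the ground ring**: the additive isomorphism
`Hⁿ(X; M)_R ≃+ Hⁿ(X; M)_S`, `[u] ↦ [u]`, for an abelian group `M` carrying an `R`- and an
`S`-module structure (Hatcher 2002, §3.1: `Hⁿ(X; G)` is defined for an abelian group `G`).
E.g. `scalarEquiv ℤ (ZMod 2) (ZMod 2) X n : Hⁿ(X; ℤ/2)_ℤ ≃+ Hⁿ(X; ℤ/2)_{ℤ/2}` connects the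
Bockstein sequence of `0 → ℤ → ℤ → ℤ/2 → 0` (ground ring `ℤ`) with the cup product and the
Steenrod squares (ring coefficients). [cite: HatcherAT2002, §3.1 p. 198] -/
def scalarEquiv (X : Type u) [TopologicalSpace X] (n : ℕ) :
    singularCohomology R M X n ≃+ singularCohomology S M X n where
  toFun := scalarChange R S M X n
  invFun := scalarChange S R M X n
  left_inv := scalarChange_scalarChange R S M
  right_inv := scalarChange_scalarChange S R M
  map_add' := map_add _

/-- `scalarEquiv` is `scalarChange`. [folklore] -/
@[simp]
lemma scalarEquiv_apply (x : singularCohomology R M X n) :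
    scalarEquiv R S M X n x = scalarChange R S M X n x := rfl

/-- The inverse of `scalarEquiv R S` is `scalarChange S R`. [folklore] -/
@[simp]
lemma scalarEquiv_symm_apply (x : singularCohomology S M X n) :
    (scalarEquiv R S M X n).symm x = scalarChange S R M X n x := rfl

/-- `scalarEquiv [u] = [u]`. [cite: HatcherAT2002, §3.1 p. 198] -/
lemma scalarEquiv_π (u : cocycles R M X n) :
    scalarEquiv R S M X n (singularCohomology.π R M X n u) =
      singularCohomology.π S M X n (cocyclesScalarChange R S M n u) :=
  scalarChange_π R S M u

/-- A class vanishes iff it vanishes after change of ground ring. [folklore] -/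
lemma scalarChange_eq_zero_iff (x : singularCohomology R M X n) :
    scalarChange R S M X n x = 0 ↔ x = 0 :=
  (scalarEquiv R S M X n).map_eq_zero_iff

end singularCohomology

end Literature.AlgebraicTopology.SingularHomology
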